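import Summits.HodgeConjecture.HodgeConjecture.Theorems.DerivedTorelliFermatTargetGlue

/-!
# Route DerivedTorelliFermat — `Assembly` (assembly item stmt-HodgeConjecture-14588)

The assembly item of route `DerivedTorelliFermat`,

  HypersurfaceLefschetz → HodgeModels → EigenspaceInputs → ShiodaAokiSupply → K3SectorAlgebraic →
    ResidualSectorComplement → HodgeConjecture,

is the route's deciding theorem `closes (hT : TargetGlue) (hL) (hM) (hE) (hS) (hK) (hC)` with its
glue hypothesis `TargetGlue` discharged by the tree's `derivedTorelliFermat_targetGlue_proof` (file
`DerivedTorelliFermatTargetGlue`: Ran's assembly of the middle degree of the Fermat fourfold from the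
eigenspace structure, transport to the given model, the other codimensions unconditional).  No
named-fact hypothesis, no sorry.
-/

-- `Summit.HodgeConjecture.HodgeConjecture.Theorems` is the mandated namespace (single-problem
-- summit: Problem = Summit), which `linter.dupNamespace` flags on every declaration; the lakefile
-- turns the linter off tree-wide (weak option), restated here so stand-alone elaboration is
-- warning-free too.
set_option linter.dupNamespace false

namespace Summit.HodgeConjecture.HodgeConjecture.Theorems

/-- **Item stmt-HodgeConjecture-14588 (`Assembly`), route `DerivedTorelliFermat`**: the route's
items imply the Hodge conjecture — the deciding theorem `DerivedTorelliFermat.closes` with its glue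
hypothesis `TargetGlue` discharged by `derivedTorelliFermat_targetGlue_proof`.  The type is the route
decl `Summit.HodgeConjecture.HodgeConjecture.Theses.DerivedTorelliFermat.Assembly`.
[cite: Ran1980, Thm. 4.9] [cite: Shioda1979PJA, §2 Thm. 1] -/
theorem derivedTorelliFermat_assembly_proof :
    Summit.HodgeConjecture.HodgeConjecture.Theses.DerivedTorelliFermat.Assembly :=
  fun hL hM hE hS hK hC ↦ Summit.HodgeConjecture.HodgeConjecture.Theses.DerivedTorelliFermat.closes
    derivedTorelliFermat_targetGlue_proof hL hM hE hS hK hC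

end Summit.HodgeConjecture.HodgeConjecture.Theorems
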